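import Literature.Analysis.Fourier.RadialSchwartzInterpolationSuperposition
import Mathlib.Analysis.SpecificLimits.Normed
import Mathlib.Analysis.PSeries
import HarnessLib

/-!
# CKMRV interpolation, step 3: the interpolation formula for Gaussian superpositions

Sibling of `Literature/Analysis/Fourier/RadialSchwartzInterpolation.lean` (the named fact
`CKMRV2022_interpolationFormula` = Cohn–Kumar–Miller–Radchenko–Viazovska, Ann. Math. 196 (2022),
Theorem 1.7). Steps 1–2 (`RadialSchwartzInterpolationGaussian.lean`,
`RadialSchwartzInterpolationSuperposition.lean`) gave the interpolation formula (1.4) for a single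
complex Gaussian `e^{πiτ|·|²}` from the functional equation (1.8), and the data of a Gaussian
superposition `S_w = ∫ w(t) e^{πi(2t+iy)|·|²} dt`. Here we integrate the Gaussian identity against
the weight `w` (the last step of the proof of CKMRV Theorem 3.1, "it suffices to prove that `Λ(f)`
vanishes when `f` is a complex Gaussian", made quantitative so as to avoid the topology of
`𝓢_rad(ℝᵈ)`): if the generating functions of a family `aₙ, bₙ, ãₙ, b̃ₙ` satisfy (1.8) along the
line `Im τ = y` at the point `x₀` and the family grows at most polynomially in `n` at `x₀`
(`|aₙ(x₀)|, … ≤ C(1+n)ᴺ`), then (1.4) holds at `x₀` for every Gaussian superposition `S_w` whose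
weight has `∫ (1+|t|)^{2N+6} |w(t)| dt < ∞`, the four series converging absolutely
(`gaussSup_eq_interpolationSum`). The exchange of `∑ₙ` and `∫ dt` rests on the elementary bounds
`e^{−u} ≤ k!/uᵏ` and `|τ(t)|² ≤ (2+y)²(1+|t|)²`, which bound the Fourier-side data
`(i/τ)^{d/2} e^{2πim(−1/τ)}`, `|e^{2πim(−1/τ)}| = e^{−2πm y/|τ|²}`, by `(1+|t|)^{2N+6}/m^{N+2}`.

Everything is proved (theorems only); no named facts.

## References

* H. Cohn, A. Kumar, S. D. Miller, D. Radchenko, M. Viazovska, *Universal optimality of the `E₈`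
  and Leech lattices and interpolation formulas*, Ann. of Math. 196 (2022) 983–1082,
  arXiv:1902.05438: §3.1, proof of Theorem 3.1 (last two paragraphs); §2.3 Lemma 2.2. [CohnEtAl2019]
-/

noncomputable section

open scoped SchwartzMap FourierTransform Topology UpperHalfPlane ContDiff RealInnerProductSpace
open Filter Complex MeasureTheory Set Metric

namespace Literature.Analysis.Fourier

/-! ## Elementary bounds -/

/-- `e^{−u} ≤ k!/uᵏ` for `u > 0` (from `uᵏ/k! ≤ eᵘ`). [folklore] -/
theorem exp_neg_le_factorial_div_pow {u : ℝ} (hu : 0 < u) (k : ℕ) :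
    Real.exp (-u) ≤ k.factorial / u ^ k := by
  have h := Real.pow_div_factorial_le_exp u hu.le k
  calc Real.exp (-u) = (Real.exp u)⁻¹ := Real.exp_neg u
    _ ≤ (u ^ k / k.factorial)⁻¹ := inv_anti₀ (by positivity) h
    _ = k.factorial / u ^ k := inv_div _ _

/-- `e^{−u} ≤ k! (1/u)ᵏ` written for `u = p/q`: `e^{−p/q} ≤ k! (q/p)ᵏ` (`p, q > 0`). [folklore] -/
theorem exp_neg_div_le_factorial_mul_pow {p q : ℝ} (hp : 0 < p) (hq : 0 < q) (k : ℕ) :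
    Real.exp (-(p / q)) ≤ k.factorial * (q / p) ^ k := by
  have h := exp_neg_le_factorial_div_pow (div_pos hp hq) k
  rwa [div_pow, div_div_eq_mul_div, mul_div_assoc, ← div_pow] at h

/-- `|e^{2πimτ}| = e^{−2πm Im τ}` (`m = n₀ + n`). [folklore] -/
theorem norm_cexp_two_pi_I_node (n₀ n : ℕ) (τ : ℂ) :
    ‖cexp (2 * Real.pi * I * ((n₀ : ℂ) + n) * τ)‖ = Real.exp (-2 * Real.pi * ((n₀ : ℝ) + n) * τ.im) := by
  rw [Complex.norm_exp]
  congr 1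
  simp [Complex.mul_re, Complex.mul_im]

/-- `|τ(t)|² = 4t² + y² ≤ ((2 + |y|)(1 + |t|))²`. [folklore] -/
theorem normSq_lineH_le (y t : ℝ) : Complex.normSq (lineH y t) ≤ ((2 + |y|) * (1 + |t|)) ^ 2 := by
  rw [Complex.normSq_eq_norm_sq]
  have h := norm_lineH_le y t
  have h2 : 2 * |t| + |y| ≤ (2 + |y|) * (1 + |t|) := by nlinarith [abs_nonneg t, abs_nonneg y]
  exact pow_le_pow_left₀ (norm_nonneg _) (h.trans h2) 2

/-- `Im(−1/τ(t)) = y/|τ(t)|²`. [folklore] -/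
theorem neg_inv_lineH_im (y t : ℝ) : (-(lineH y t)⁻¹).im = y / Complex.normSq (lineH y t) := by
  simp [Complex.inv_im, neg_div]

/-- `node n₀ n = √(2(n₀+n)) ≤ 2 n₀ (1 + n)` for `n₀ ≥ 1`. [folklore] -/
theorem node_le {n₀ : ℕ} (h : 1 ≤ n₀) (n : ℕ) : node n₀ n ≤ 2 * n₀ * (1 + n) := by
  have hn0 : (1 : ℝ) ≤ n₀ := by exact_mod_cast h
  have hn : (0 : ℝ) ≤ n := Nat.cast_nonneg n
  have h1 : node n₀ n ≤ 2 * ((n₀ : ℝ) + n) := by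
    rw [node, Real.sqrt_le_left (by positivity)]
    nlinarith
  nlinarith

/-- `(1+n)ᴹ/(n₀+n)^{M+2} ≤ 1/(1+n)²` for `n₀ ≥ 1`. [folklore] -/
theorem pow_div_pow_add_two_le {n₀ : ℕ} (h : 1 ≤ n₀) (M n : ℕ) :
    (1 + (n : ℝ)) ^ M / ((n₀ : ℝ) + n) ^ (M + 2) ≤ 1 / (1 + (n : ℝ)) ^ 2 := by
  have h1 : (1 : ℝ) + n ≤ n₀ + n := by
    have : (1 : ℝ) ≤ n₀ := by exact_mod_cast h
    linarith
  have hpos : (0 : ℝ) < 1 + n := by positivity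
  rw [div_le_div_iff₀ (by positivity) (by positivity), one_mul, ← pow_add]
  exact pow_le_pow_left₀ hpos.le h1 _

/-- Summability of `(1+n)ᴹ rⁿ` for `0 ≤ r < 1`. [folklore] -/
theorem summable_one_add_pow_mul_geometric {r : ℝ} (hr0 : 0 ≤ r) (hr : r < 1) (M : ℕ) :
    Summable fun n : ℕ => (1 + (n : ℝ)) ^ M * r ^ n := by
  rcases eq_or_lt_of_le hr0 with h | h
  · subst h
    refine summable_of_ne_finset_zero (s := {0}) fun n hn => ?_
    rw [Finset.mem_singleton] at hn
    simp [zero_pow hn]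
  · have hs : Summable fun n : ℕ => ((n : ℝ)) ^ M * r ^ n :=
      summable_pow_mul_geometric_of_norm_lt_one M (by rwa [Real.norm_of_nonneg hr0])
    have hs' := (summable_nat_add_iff 1).2 hs
    have : (fun n : ℕ => (1 + (n : ℝ)) ^ M * r ^ n) =
        fun n : ℕ => r⁻¹ * ((((n + 1 : ℕ) : ℝ)) ^ M * r ^ (n + 1)) := by
      funext n
      rw [pow_succ]
      field_simp
      push_cast
      ring
    rw [this]
    exact hs'.mul_left _

/-- Summability of `1/(1+n)²`. [folklore] -/
theorem summable_one_div_one_add_sq : Summable fun n : ℕ => 1 / (1 + (n : ℝ)) ^ 2 := by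
  have h := (summable_nat_add_iff 1).2 (Real.summable_one_div_nat_pow.2 one_lt_two)
  refine h.congr fun n => ?_
  push_cast
  ring

/-- `(1 + |t|)ʲ ≤ (1 + |t|)ᵏ` for `j ≤ k`. [folklore] -/
theorem one_add_abs_pow_le {j k : ℕ} (h : j ≤ k) (t : ℝ) : (1 + |t|) ^ j ≤ (1 + |t|) ^ k :=
  pow_le_pow_right₀ (by linarith [abs_nonneg t]) h

/-! ## The domination scheme for exchanging `∑ₙ` and `∫ dt` -/

/-- **Domination scheme.** If `‖Fₙ(t)‖ ≤ β(t) gₙ` with `β` integrable and `g` summable (and the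
`Fₙ` measurable), then every `Fₙ` is integrable, `∑ₙ ∫ ‖Fₙ‖ < ∞`, and `∑ₙ ‖Fₙ(t)‖` converges for
every `t`. [folklore] -/
theorem dominated_family {F : ℕ → ℝ → ℂ} {β : ℝ → ℝ} {g : ℕ → ℝ}
    (hmeas : ∀ n, AEStronglyMeasurable (F n) volume) (hβ : Integrable β) (hg : Summable g)
    (hbound : ∀ n t, ‖F n t‖ ≤ β t * g n) :
    (∀ n, Integrable (F n)) ∧ (Summable fun n => ∫ t, ‖F n t‖) ∧
      ∀ t, Summable fun n => ‖F n t‖ := by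
  have hint : ∀ n, Integrable (F n) := fun n =>
    (hβ.mul_const (g n)).mono' (hmeas n) (Eventually.of_forall fun t => hbound n t)
  refine ⟨hint, ?_, fun t => ?_⟩
  · refine Summable.of_nonneg_of_le (fun n => integral_nonneg fun t => norm_nonneg _)
      (fun n => ?_) (hg.mul_left (∫ t, β t))
    calc ∫ t, ‖F n t‖ ≤ ∫ t, β t * g n :=
          integral_mono (hint n).norm (hβ.mul_const _) fun t => hbound n t
      _ = (∫ t, β t) * g n := integral_mul_const _ _
  · exact Summable.of_nonneg_of_le (fun n => norm_nonneg _) (fun n => hbound n t) (hg.mul_left _)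

/-- Splitting `∫ ∑ₙ (F¹ₙ + F²ₙ + F³ₙ + F⁴ₙ)` into four absolutely convergent series of integrals,
for four dominated families. [folklore] -/
theorem integral_tsum_add_four {F₁ F₂ F₃ F₄ : ℕ → ℝ → ℂ}
    (h₁ : (∀ n, Integrable (F₁ n)) ∧ (Summable fun n => ∫ t, ‖F₁ n t‖) ∧ ∀ t, Summable fun n => ‖F₁ n t‖)
    (h₂ : (∀ n, Integrable (F₂ n)) ∧ (Summable fun n => ∫ t, ‖F₂ n t‖) ∧ ∀ t, Summable fun n => ‖F₂ n t‖)
    (h₃ : (∀ n, Integrable (F₃ n)) ∧ (Summable fun n => ∫ t, ‖F₃ n t‖) ∧ ∀ t, Summable fun n => ‖F₃ n t‖)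
    (h₄ : (∀ n, Integrable (F₄ n)) ∧ (Summable fun n => ∫ t, ‖F₄ n t‖) ∧ ∀ t, Summable fun n => ‖F₄ n t‖) :
    (∫ t, (∑' n, F₁ n t) + (∑' n, F₂ n t) + (∑' n, F₃ n t) + (∑' n, F₄ n t)) =
      (∑' n, ∫ t, F₁ n t) + (∑' n, ∫ t, F₂ n t) + (∑' n, ∫ t, F₃ n t) + (∑' n, ∫ t, F₄ n t) := by
  obtain ⟨i₁, s₁, p₁⟩ := h₁
  obtain ⟨i₂, s₂, p₂⟩ := h₂
  obtain ⟨i₃, s₃, p₃⟩ := h₃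
  obtain ⟨i₄, s₄, p₄⟩ := h₄
  set H : ℕ → ℝ → ℂ := fun n t => F₁ n t + F₂ n t + F₃ n t + F₄ n t with hH
  have hHint : ∀ n, Integrable (H n) := fun n => ((i₁ n).add (i₂ n)).add (i₃ n) |>.add (i₄ n)
  have hadd4 : ∀ {f₁ f₂ f₃ f₄ : ℝ → ℂ}, Integrable f₁ → Integrable f₂ → Integrable f₃ → Integrable f₄ →
      (∫ t, f₁ t + f₂ t + f₃ t + f₄ t) = (∫ t, f₁ t) + (∫ t, f₂ t) + (∫ t, f₃ t) + ∫ t, f₄ t := by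
    intro f₁ f₂ f₃ f₄ j₁ j₂ j₃ j₄
    have j₁₂ : Integrable (fun t => f₁ t + f₂ t) := j₁.add j₂
    have j₁₂₃ : Integrable (fun t => f₁ t + f₂ t + f₃ t) := j₁₂.add j₃
    rw [integral_add j₁₂₃ j₄, integral_add j₁₂ j₃, integral_add j₁ j₂]
  have hadd4r : ∀ {f₁ f₂ f₃ f₄ : ℝ → ℝ}, Integrable f₁ → Integrable f₂ → Integrable f₃ → Integrable f₄ →
      (∫ t, f₁ t + f₂ t + f₃ t + f₄ t) = (∫ t, f₁ t) + (∫ t, f₂ t) + (∫ t, f₃ t) + ∫ t, f₄ t := by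
    intro f₁ f₂ f₃ f₄ j₁ j₂ j₃ j₄
    have j₁₂ : Integrable (fun t => f₁ t + f₂ t) := j₁.add j₂
    have j₁₂₃ : Integrable (fun t => f₁ t + f₂ t + f₃ t) := j₁₂.add j₃
    rw [integral_add j₁₂₃ j₄, integral_add j₁₂ j₃, integral_add j₁ j₂]
  have hHsum : Summable fun n => ∫ t, ‖H n t‖ := by
    refine Summable.of_nonneg_of_le (fun n => integral_nonneg fun t => norm_nonneg _) (fun n => ?_)
      (((s₁.add s₂).add s₃).add s₄)
    have jsum : Integrable (fun t => ‖F₁ n t‖ + ‖F₂ n t‖ + ‖F₃ n t‖ + ‖F₄ n t‖) :=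
      (((i₁ n).norm.add (i₂ n).norm).add (i₃ n).norm).add (i₄ n).norm
    calc ∫ t, ‖H n t‖ ≤ ∫ t, ‖F₁ n t‖ + ‖F₂ n t‖ + ‖F₃ n t‖ + ‖F₄ n t‖ := by
          refine integral_mono (hHint n).norm jsum fun t => ?_
          simp only [hH]
          exact (norm_add_le _ _).trans (add_le_add ((norm_add_le _ _).trans
            (add_le_add (norm_add_le _ _) le_rfl)) le_rfl)
      _ = (∫ t, ‖F₁ n t‖) + (∫ t, ‖F₂ n t‖) + (∫ t, ‖F₃ n t‖) + ∫ t, ‖F₄ n t‖ :=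
          hadd4r (i₁ n).norm (i₂ n).norm (i₃ n).norm (i₄ n).norm
  have hpt : ∀ t, (∑' n, F₁ n t) + (∑' n, F₂ n t) + (∑' n, F₃ n t) + (∑' n, F₄ n t) = ∑' n, H n t := by
    intro t
    rw [← Summable.tsum_add (p₁ t).of_norm (p₂ t).of_norm,
      ← Summable.tsum_add ((p₁ t).of_norm.add (p₂ t).of_norm) (p₃ t).of_norm,
      ← Summable.tsum_add (((p₁ t).of_norm.add (p₂ t).of_norm).add (p₃ t).of_norm) (p₄ t).of_norm]
  have hA : ∀ {F : ℕ → ℝ → ℂ}, (∀ n, Integrable (F n)) → (Summable fun n => ∫ t, ‖F n t‖) →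
      Summable fun n => ∫ t, F n t := fun hi hs =>
    hs.of_norm_bounded fun n => norm_integral_le_integral_norm _
  calc (∫ t, (∑' n, F₁ n t) + (∑' n, F₂ n t) + (∑' n, F₃ n t) + (∑' n, F₄ n t))
      = ∫ t, ∑' n, H n t := integral_congr_ae (Eventually.of_forall hpt)
    _ = ∑' n, ∫ t, H n t := (integral_tsum_of_summable_integral_norm hHint hHsum).symm
    _ = ∑' n, ((∫ t, F₁ n t) + (∫ t, F₂ n t) + (∫ t, F₃ n t) + ∫ t, F₄ n t) := by
        congr 1; funext n
        simp only [hH]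
        exact hadd4 (i₁ n) (i₂ n) (i₃ n) (i₄ n)
    _ = (∑' n, ∫ t, F₁ n t) + (∑' n, ∫ t, F₂ n t) + (∑' n, ∫ t, F₃ n t) + (∑' n, ∫ t, F₄ n t) := by
        rw [Summable.tsum_add (((hA i₁ s₁).add (hA i₂ s₂)).add (hA i₃ s₃)) (hA i₄ s₄),
          Summable.tsum_add ((hA i₁ s₁).add (hA i₂ s₂)) (hA i₃ s₃),
          Summable.tsum_add (hA i₁ s₁) (hA i₂ s₂)]

/-! ## Bounds for the four kinds of Gaussian data along the line `τ(t) = 2t + iy` -/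

section Bounds

variable {d : ℕ} {n₀ : ℕ} {y : ℝ} {C : ℝ} {N : ℕ}

/-- Direct values: `|e^{2πimτ(t)}| |aₙ| ≤ C(1+n)ᴺ (e^{−2πy})ⁿ`. [folklore] -/
theorem norm_data₁_le (hy : 0 < y) {α : ℂ} (n : ℕ) (hα : ‖α‖ ≤ C * (1 + n) ^ N) (t : ℝ) :
    ‖cexp (2 * Real.pi * I * ((n₀ : ℂ) + n) * lineH y t) * α‖ ≤
      C * (1 + n) ^ N * Real.exp (-2 * Real.pi * y) ^ n := by
  rw [norm_mul, norm_cexp_two_pi_I_node, lineH_im]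
  have hexp : Real.exp (-2 * Real.pi * ((n₀ : ℝ) + n) * y) ≤ Real.exp (-2 * Real.pi * y) ^ n := by
    rw [← Real.exp_nat_mul, Real.exp_le_exp]
    have h0 : (0 : ℝ) ≤ n₀ := Nat.cast_nonneg _
    nlinarith [Real.pi_pos, mul_nonneg (mul_nonneg Real.pi_pos.le h0) hy.le]
  calc Real.exp (-2 * Real.pi * ((n₀ : ℝ) + n) * y) * ‖α‖
      ≤ Real.exp (-2 * Real.pi * y) ^ n * (C * (1 + n) ^ N) :=
        mul_le_mul hexp hα (norm_nonneg _) (by positivity)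
    _ = _ := by ring

/-- Direct derivatives: `|2πiτ(t) √(2m) e^{2πimτ(t)}| |bₙ| ≤ (1+|t|) · 4π(2+y)n₀ C (1+n)^{N+1} (e^{−2πy})ⁿ`
(`n₀ ≥ 1`). [folklore] -/
theorem norm_data₂_le (hy : 0 < y) (hn₀ : 1 ≤ n₀) {α : ℂ} (n : ℕ) (hα : ‖α‖ ≤ C * (1 + n) ^ N)
    (t : ℝ) :
    ‖2 * Real.pi * I * lineH y t * (node n₀ n : ℂ) * cexp (2 * Real.pi * I * ((n₀ : ℂ) + n) * lineH y t) * α‖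
      ≤ (1 + |t|) * (4 * Real.pi * (2 + y) * n₀ * C * (1 + n) ^ (N + 1) * Real.exp (-2 * Real.pi * y) ^ n) := by
  have h1 := norm_data₁_le (n₀ := n₀) hy n hα t
  have hτ : ‖lineH y t‖ ≤ (2 + y) * (1 + |t|) := by
    have := norm_lineH_le y t
    rw [abs_of_pos hy] at this
    nlinarith [abs_nonneg t, hy]
  have hnode : ‖(node n₀ n : ℂ)‖ ≤ 2 * n₀ * (1 + n) := by
    rw [Complex.norm_real, Real.norm_of_nonneg (node_nonneg _ _)]
    exact node_le hn₀ n
  have h2pi : ‖(2 : ℂ) * Real.pi * I‖ = 2 * Real.pi := by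
    simp [Complex.norm_real, abs_of_pos Real.pi_pos]
  rw [show (2 : ℂ) * Real.pi * I * lineH y t * (node n₀ n : ℂ) *
      cexp (2 * Real.pi * I * ((n₀ : ℂ) + n) * lineH y t) * α =
      ((2 : ℂ) * Real.pi * I) * (lineH y t * ((node n₀ n : ℂ) *
        (cexp (2 * Real.pi * I * ((n₀ : ℂ) + n) * lineH y t) * α))) by ring]
  rw [norm_mul ((2 : ℂ) * Real.pi * I), norm_mul (lineH y t), norm_mul ((node n₀ n : ℂ)), h2pi]
  calc 2 * Real.pi * (‖lineH y t‖ * (‖(node n₀ n : ℂ)‖ *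
        ‖cexp (2 * Real.pi * I * ((n₀ : ℂ) + n) * lineH y t) * α‖))
      ≤ 2 * Real.pi * (((2 + y) * (1 + |t|)) * ((2 * n₀ * (1 + n)) *
        (C * (1 + n) ^ N * Real.exp (-2 * Real.pi * y) ^ n))) := by
        gcongr
    _ = _ := by ring

/-- `|τ(t)|²/(2πm y)`, raised to the power `k`, against `((2+y)(1+|t|))^{2k}`. [folklore] -/
theorem normSq_lineH_div_pow_le (hy : 0 < y) {m : ℝ} (hm : 0 < m) (k : ℕ) (t : ℝ) :
    (Complex.normSq (lineH y t) / (2 * Real.pi * m * y)) ^ k ≤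
      ((2 + y) * (1 + |t|)) ^ (2 * k) * ((2 * Real.pi * y) ^ k)⁻¹ * (m ^ k)⁻¹ := by
  have h := normSq_lineH_le y t
  rw [abs_of_pos hy] at h
  calc (Complex.normSq (lineH y t) / (2 * Real.pi * m * y)) ^ k
      ≤ (((2 + y) * (1 + |t|)) ^ 2 / (2 * Real.pi * m * y)) ^ k :=
        pow_le_pow_left₀ (div_nonneg (Complex.normSq_nonneg _) (by positivity))
          (div_le_div_of_nonneg_right h (by positivity)) k
    _ = ((2 + y) * (1 + |t|)) ^ (2 * k) * ((2 * Real.pi * y) ^ k)⁻¹ * (m ^ k)⁻¹ := by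
        rw [div_pow, ← pow_mul]
        simp only [mul_pow, mul_inv, div_eq_mul_inv]
        ring

/-- Fourier-side values: `|(i/τ)^{d/2} e^{2πim(−1/τ)}| |ãₙ| ≤ (1+|t|)^{2N+4} · K₃ (1+n)ᴺ/m^{N+2}`,
`m = n₀ + n`, with `K₃ = y^{−d/2} (N+2)! (2+y)^{2N+4}/(2πy)^{N+2} · C` (`n₀ ≥ 1`; from
`e^{−u} ≤ (N+2)!/u^{N+2}` with `u = 2πm y/|τ|²`). [folklore] -/
theorem norm_data₃_le (hy : 0 < y) (hn₀ : 1 ≤ n₀) {α : ℂ} (n : ℕ) (hα : ‖α‖ ≤ C * (1 + n) ^ N)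
    (t : ℝ) :
    ‖(I / lineH y t) ^ ((d : ℂ) / 2) * cexp (2 * Real.pi * I * ((n₀ : ℂ) + n) * (-(lineH y t)⁻¹)) * α‖
      ≤ (1 + |t|) ^ (2 * (N + 2)) * ((y⁻¹ ^ ((d : ℝ) / 2) * (N + 2).factorial * (2 + y) ^ (2 * (N + 2)) *
          ((2 * Real.pi * y) ^ (N + 2))⁻¹ * C) *
            ((1 + (n : ℝ)) ^ N * (((n₀ : ℝ) + n) ^ (N + 2))⁻¹)) := by
  have hm : (0 : ℝ) < (n₀ : ℝ) + n := by
    have : (1 : ℝ) ≤ n₀ := by exact_mod_cast hn₀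
    linarith [(Nat.cast_nonneg n : (0 : ℝ) ≤ n)]
  have hnsq : 0 < Complex.normSq (lineH y t) := Complex.normSq_pos.2 (lineH_ne_zero hy.ne' t)
  have hd : ((d : ℂ) / 2) = (((d : ℝ) / 2 : ℝ) : ℂ) := by push_cast; ring
  have f1 : ‖(I / lineH y t) ^ ((d : ℂ) / 2)‖ ≤ y⁻¹ ^ ((d : ℝ) / 2) := by
    rw [hd]; exact norm_I_div_lineH_cpow_le hy (by positivity) t
  have f2 : ‖cexp (2 * Real.pi * I * ((n₀ : ℂ) + n) * (-(lineH y t)⁻¹))‖ ≤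
      (N + 2).factorial * (((2 + y) * (1 + |t|)) ^ (2 * (N + 2)) * ((2 * Real.pi * y) ^ (N + 2))⁻¹ *
        (((n₀ : ℝ) + n) ^ (N + 2))⁻¹) := by
    rw [norm_cexp_two_pi_I_node, neg_inv_lineH_im]
    have hp : 0 < 2 * Real.pi * ((n₀ : ℝ) + n) * y := by positivity
    have h := exp_neg_div_le_factorial_mul_pow hp hnsq (N + 2)
    have e : -2 * Real.pi * ((n₀ : ℝ) + n) * (y / Complex.normSq (lineH y t)) =
        -(2 * Real.pi * ((n₀ : ℝ) + n) * y / Complex.normSq (lineH y t)) := by ring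
    rw [e]
    refine h.trans ?_
    gcongr
    exact normSq_lineH_div_pow_le hy hm (N + 2) t
  rw [norm_mul, norm_mul]
  calc ‖(I / lineH y t) ^ ((d : ℂ) / 2)‖ * ‖cexp (2 * Real.pi * I * ((n₀ : ℂ) + n) * (-(lineH y t)⁻¹))‖ * ‖α‖
      ≤ y⁻¹ ^ ((d : ℝ) / 2) * ((N + 2).factorial * (((2 + y) * (1 + |t|)) ^ (2 * (N + 2)) *
          ((2 * Real.pi * y) ^ (N + 2))⁻¹ * (((n₀ : ℝ) + n) ^ (N + 2))⁻¹)) * (C * (1 + n) ^ N) :=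
        mul_le_mul (mul_le_mul f1 f2 (norm_nonneg _) (by positivity)) hα (norm_nonneg _)
          (by positivity)
    _ = _ := by rw [mul_pow]; ring

/-- Fourier-side derivatives:
`|(i/τ)^{d/2} 2πi(−1/τ) √(2m) e^{2πim(−1/τ)}| |b̃ₙ| ≤ (1+|t|)^{2N+6} · K₄ (1+n)^{N+1}/m^{N+3}` with
`K₄ = y^{−d/2} (4π n₀/y) (N+3)! (2+y)^{2N+6}/(2πy)^{N+3} · C` (`n₀ ≥ 1`). [folklore] -/
theorem norm_data₄_le (hy : 0 < y) (hn₀ : 1 ≤ n₀) {α : ℂ} (n : ℕ) (hα : ‖α‖ ≤ C * (1 + n) ^ N)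
    (t : ℝ) :
    ‖(I / lineH y t) ^ ((d : ℂ) / 2) * (2 * Real.pi * I * (-(lineH y t)⁻¹) * (node n₀ n : ℂ) *
        cexp (2 * Real.pi * I * ((n₀ : ℂ) + n) * (-(lineH y t)⁻¹))) * α‖
      ≤ (1 + |t|) ^ (2 * (N + 3)) * ((y⁻¹ ^ ((d : ℝ) / 2) * (4 * Real.pi * n₀ * y⁻¹) *
          (N + 3).factorial * (2 + y) ^ (2 * (N + 3)) * ((2 * Real.pi * y) ^ (N + 3))⁻¹ * C) *
            ((1 + (n : ℝ)) ^ (N + 1) * (((n₀ : ℝ) + n) ^ (N + 3))⁻¹)) := by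
  have hm : (0 : ℝ) < (n₀ : ℝ) + n := by
    have : (1 : ℝ) ≤ n₀ := by exact_mod_cast hn₀
    linarith [(Nat.cast_nonneg n : (0 : ℝ) ≤ n)]
  have hnsq : 0 < Complex.normSq (lineH y t) := Complex.normSq_pos.2 (lineH_ne_zero hy.ne' t)
  have hd : ((d : ℂ) / 2) = (((d : ℝ) / 2 : ℝ) : ℂ) := by push_cast; ring
  have f1 : ‖(I / lineH y t) ^ ((d : ℂ) / 2)‖ ≤ y⁻¹ ^ ((d : ℝ) / 2) := by
    rw [hd]; exact norm_I_div_lineH_cpow_le hy (by positivity) t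
  have f2 : ‖cexp (2 * Real.pi * I * ((n₀ : ℂ) + n) * (-(lineH y t)⁻¹))‖ ≤
      (N + 3).factorial * (((2 + y) * (1 + |t|)) ^ (2 * (N + 3)) * ((2 * Real.pi * y) ^ (N + 3))⁻¹ *
        (((n₀ : ℝ) + n) ^ (N + 3))⁻¹) := by
    rw [norm_cexp_two_pi_I_node, neg_inv_lineH_im]
    have hp : 0 < 2 * Real.pi * ((n₀ : ℝ) + n) * y := by positivity
    have h := exp_neg_div_le_factorial_mul_pow hp hnsq (N + 3)
    have e : -2 * Real.pi * ((n₀ : ℝ) + n) * (y / Complex.normSq (lineH y t)) =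
        -(2 * Real.pi * ((n₀ : ℝ) + n) * y / Complex.normSq (lineH y t)) := by ring
    rw [e]
    refine h.trans ?_
    gcongr
    exact normSq_lineH_div_pow_le hy hm (N + 3) t
  have fσ : ‖(2 : ℂ) * Real.pi * I * (-(lineH y t)⁻¹) * (node n₀ n : ℂ)‖ ≤
      2 * Real.pi * y⁻¹ * (2 * n₀ * (1 + n)) := by
    rw [norm_mul, norm_mul, norm_mul, norm_mul, norm_neg]
    simp only [Complex.norm_ofNat, Complex.norm_real, Real.norm_eq_abs, abs_of_pos Real.pi_pos,
      Complex.norm_I, mul_one, abs_of_nonneg (node_nonneg _ _)]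
    exact mul_le_mul (mul_le_mul_of_nonneg_left (norm_inv_lineH_le hy t) (by positivity))
      (node_le hn₀ n) (node_nonneg _ _) (by positivity)
  rw [show (I / lineH y t) ^ ((d : ℂ) / 2) * (2 * Real.pi * I * (-(lineH y t)⁻¹) * (node n₀ n : ℂ) *
        cexp (2 * Real.pi * I * ((n₀ : ℂ) + n) * (-(lineH y t)⁻¹))) * α =
      (I / lineH y t) ^ ((d : ℂ) / 2) * (((2 : ℂ) * Real.pi * I * (-(lineH y t)⁻¹) * (node n₀ n : ℂ)) *
        (cexp (2 * Real.pi * I * ((n₀ : ℂ) + n) * (-(lineH y t)⁻¹)) * α)) by ring]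
  rw [norm_mul ((I / lineH y t) ^ ((d : ℂ) / 2)),
    norm_mul ((2 : ℂ) * Real.pi * I * (-(lineH y t)⁻¹) * (node n₀ n : ℂ)),
    norm_mul (cexp (2 * Real.pi * I * ((n₀ : ℂ) + n) * (-(lineH y t)⁻¹)))]
  calc ‖(I / lineH y t) ^ ((d : ℂ) / 2)‖ * (‖(2 : ℂ) * Real.pi * I * (-(lineH y t)⁻¹) * (node n₀ n : ℂ)‖ *
        (‖cexp (2 * Real.pi * I * ((n₀ : ℂ) + n) * (-(lineH y t)⁻¹))‖ * ‖α‖))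
      ≤ y⁻¹ ^ ((d : ℝ) / 2) * ((2 * Real.pi * y⁻¹ * (2 * n₀ * (1 + n))) *
          (((N + 3).factorial * (((2 + y) * (1 + |t|)) ^ (2 * (N + 3)) * ((2 * Real.pi * y) ^ (N + 3))⁻¹ *
            (((n₀ : ℝ) + n) ^ (N + 3))⁻¹)) * (C * (1 + n) ^ N))) :=
        mul_le_mul f1 (mul_le_mul fσ (mul_le_mul f2 hα (norm_nonneg _) (by positivity))
          (by positivity) (by positivity)) (by positivity) (by positivity)
    _ = _ := by rw [mul_pow, pow_succ (1 + (n : ℝ)) N]; ring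

end Bounds

/-! ## The interpolation formula for Gaussian superpositions -/

section Main

variable {d : ℕ} [NeZero d]

/-- Summability of `(1+n)ᴹ/(n₀+n)^{M+2}` (`n₀ ≥ 1`). [folklore] -/
theorem summable_pow_mul_inv_pow_add_two {n₀ : ℕ} (h : 1 ≤ n₀) (M : ℕ) :
    Summable fun n : ℕ => (1 + (n : ℝ)) ^ M * (((n₀ : ℝ) + n) ^ (M + 2))⁻¹ := by
  refine Summable.of_nonneg_of_le (fun n => by positivity) (fun n => ?_) summable_one_div_one_add_sq
  rw [← div_eq_mul_inv]
  exact pow_div_pow_add_two_le h M n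

/-- `|t| |w(t)|` is dominated by `(1+|t|)ᵏ |w(t)|` (`k ≥ 1`): the first moment of the weight is
finite. [folklore] -/
theorem integrable_ofReal_mul_of_moment {w : ℝ → ℂ} (hw : Integrable w) {k : ℕ} (hk : 1 ≤ k)
    (hwK : Integrable fun t : ℝ => (1 + |t|) ^ k * ‖w t‖) :
    Integrable fun t : ℝ => (t : ℂ) * w t := by
  refine hwK.mono' (Complex.continuous_ofReal.aestronglyMeasurable.mul hw.aestronglyMeasurable)
    (Eventually.of_forall fun t => ?_)
  rw [norm_mul, Complex.norm_real, Real.norm_eq_abs]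
  refine mul_le_mul_of_nonneg_right ?_ (norm_nonneg _)
  calc |t| ≤ (1 + |t|) ^ 1 := by rw [pow_one]; linarith [abs_nonneg t]
    _ ≤ (1 + |t|) ^ k := one_add_abs_pow_le hk t

/-- **The interpolation formula for Gaussian superpositions** (the last step of the proof of
CKMRV Theorem 3.1, in quantitative, density-free form). Let `aₙ, bₙ, ãₙ, b̃ₙ` (`n ≥ n₀ ≥ 1`,
enumerated as `n₀ + n`) be functions on `ℝᵈ` growing at most polynomially in `n` at the point
`x₀`, whose generating functions (1.6)–(1.7) satisfy the functional equation (1.8)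
`F(τ,x₀) + (i/τ)^{d/2} F̃(−1/τ,x₀) = e^{πiτ|x₀|²}` along the line `τ = 2t + iy` (`y > 0`). Then for
every weight `w` with `∫ (1+|t|)^{2N+6} |w(t)| dt < ∞` the Gaussian superposition
`S(x) = ∫ w(t) e^{πi(2t+iy)|x|²} dt` satisfies the interpolation formula (1.4) at `x₀`,
`S(x₀) = ∑ S(√(2m)) aₘ(x₀) + ∑ S′(√(2m)) bₘ(x₀) + ∑ Ŝ(√(2m)) ãₘ(x₀) + ∑ Ŝ′(√(2m)) b̃ₘ(x₀)`,
the four series converging absolutely (CKMRV: "it suffices to prove that `Λ(f)` vanishes when `f`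
is a complex Gaussian … This condition amounts to the functional equation (1.8)"; here `Λ` is
integrated against `w`, exchanging `∑` and `∫` by domination). [cite: CohnEtAl2019, §3.1 (proof of Theorem 3.1)] -/
theorem gaussSup_eq_interpolationSum {n₀ : ℕ} (hn₀ : 1 ≤ n₀)
    (a b a' b' : ℕ → EuclideanSpace ℝ (Fin d) → ℂ) (x₀ : EuclideanSpace ℝ (Fin d))
    {C : ℝ} {N : ℕ} (ha : ∀ n, ‖a n x₀‖ ≤ C * (1 + n) ^ N) (hb : ∀ n, ‖b n x₀‖ ≤ C * (1 + n) ^ N)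
    (ha' : ∀ n, ‖a' n x₀‖ ≤ C * (1 + n) ^ N) (hb' : ∀ n, ‖b' n x₀‖ ≤ C * (1 + n) ^ N)
    {y : ℝ} (hy : 0 < y)
    (hFE : ∀ t : ℝ, genFun n₀ a b (lineH y t) x₀ +
      (I / lineH y t) ^ ((d : ℂ) / 2) * genFun n₀ a' b' (-(lineH y t)⁻¹) x₀ =
        cexp (Real.pi * I * lineH y t * ‖x₀‖ ^ 2))
    {w : ℝ → ℂ} (hw : Integrable w)
    (hwK : Integrable fun t : ℝ => (1 + |t|) ^ (2 * (N + 3)) * ‖w t‖) :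
    (Summable fun n => ‖radialValue (gaussSup w y : EuclideanSpace ℝ (Fin d) → ℂ) (node n₀ n) * a n x₀‖) ∧
    (Summable fun n => ‖radialDeriv (gaussSup w y : EuclideanSpace ℝ (Fin d) → ℂ) (node n₀ n) * b n x₀‖) ∧
    (Summable fun n =>
      ‖radialValue (𝓕 (gaussSup w y : EuclideanSpace ℝ (Fin d) → ℂ)) (node n₀ n) * a' n x₀‖) ∧
    (Summable fun n =>
      ‖radialDeriv (𝓕 (gaussSup w y : EuclideanSpace ℝ (Fin d) → ℂ)) (node n₀ n) * b' n x₀‖) ∧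
    gaussSup w y x₀ =
      (∑' n, radialValue (gaussSup w y : EuclideanSpace ℝ (Fin d) → ℂ) (node n₀ n) * a n x₀) +
      (∑' n, radialDeriv (gaussSup w y : EuclideanSpace ℝ (Fin d) → ℂ) (node n₀ n) * b n x₀) +
      (∑' n, radialValue (𝓕 (gaussSup w y : EuclideanSpace ℝ (Fin d) → ℂ)) (node n₀ n) * a' n x₀) +
      (∑' n, radialDeriv (𝓕 (gaussSup w y : EuclideanSpace ℝ (Fin d) → ℂ)) (node n₀ n) * b' n x₀) := by
  have hy0 : y ≠ 0 := hy.ne'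
  have hC : 0 ≤ C := le_trans (norm_nonneg _) (by simpa using ha 0)
  have hw1 : Integrable fun t : ℝ => (t : ℂ) * w t :=
    integrable_ofReal_mul_of_moment hw (by omega) hwK
  -- the four families of integrands
  set F₁ : ℕ → ℝ → ℂ := fun n t =>
    w t * (cexp (2 * Real.pi * I * ((n₀ : ℂ) + n) * lineH y t) * a n x₀) with hF₁
  set F₂ : ℕ → ℝ → ℂ := fun n t => w t * (2 * Real.pi * I * lineH y t * (node n₀ n : ℂ) *
    cexp (2 * Real.pi * I * ((n₀ : ℂ) + n) * lineH y t) * b n x₀) with hF₂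
  set F₃ : ℕ → ℝ → ℂ := fun n t => w t * ((I / lineH y t) ^ ((d : ℂ) / 2) *
    cexp (2 * Real.pi * I * ((n₀ : ℂ) + n) * (-(lineH y t)⁻¹)) * a' n x₀) with hF₃
  set F₄ : ℕ → ℝ → ℂ := fun n t => w t * ((I / lineH y t) ^ ((d : ℂ) / 2) *
    (2 * Real.pi * I * (-(lineH y t)⁻¹) * (node n₀ n : ℂ) *
      cexp (2 * Real.pi * I * ((n₀ : ℂ) + n) * (-(lineH y t)⁻¹))) * b' n x₀) with hF₄
  set β : ℝ → ℝ := fun t => (1 + |t|) ^ (2 * (N + 3)) * ‖w t‖ with hβ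
  -- continuity of the `t`-dependence (for measurability)
  have hcpow : Continuous fun t : ℝ => (I / lineH y t) ^ ((d : ℂ) / 2) :=
    Continuous.cpow (continuous_const.div (continuous_lineH y) (lineH_ne_zero hy0))
      continuous_const (fun t => I_div_lineH_mem_slitPlane hy t)
  have hcinv : Continuous fun t : ℝ => (lineH y t)⁻¹ := (continuous_lineH y).inv₀ (lineH_ne_zero hy0)
  have hm₁ : ∀ n, AEStronglyMeasurable (F₁ n) volume := fun n =>
    hw.aestronglyMeasurable.mul (by fun_prop : Continuous fun t : ℝ =>
      cexp (2 * Real.pi * I * ((n₀ : ℂ) + n) * lineH y t) * a n x₀).aestronglyMeasurable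
  have hm₂ : ∀ n, AEStronglyMeasurable (F₂ n) volume := fun n =>
    hw.aestronglyMeasurable.mul (by fun_prop : Continuous fun t : ℝ =>
      2 * Real.pi * I * lineH y t * (node n₀ n : ℂ) *
        cexp (2 * Real.pi * I * ((n₀ : ℂ) + n) * lineH y t) * b n x₀).aestronglyMeasurable
  have hm₃ : ∀ n, AEStronglyMeasurable (F₃ n) volume := fun n =>
    hw.aestronglyMeasurable.mul (by fun_prop : Continuous fun t : ℝ => (I / lineH y t) ^ ((d : ℂ) / 2) *
      cexp (2 * Real.pi * I * ((n₀ : ℂ) + n) * (-(lineH y t)⁻¹)) * a' n x₀).aestronglyMeasurable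
  have hm₄ : ∀ n, AEStronglyMeasurable (F₄ n) volume := fun n =>
    hw.aestronglyMeasurable.mul (by fun_prop : Continuous fun t : ℝ => (I / lineH y t) ^ ((d : ℂ) / 2) *
      (2 * Real.pi * I * (-(lineH y t)⁻¹) * (node n₀ n : ℂ) *
        cexp (2 * Real.pi * I * ((n₀ : ℂ) + n) * (-(lineH y t)⁻¹))) * b' n x₀).aestronglyMeasurable
  -- `‖w t‖ (1+|t|)ʲ ≤ β t` for `j ≤ 2N+6`
  have hwβ : ∀ {j : ℕ}, j ≤ 2 * (N + 3) → ∀ t, ‖w t‖ * (1 + |t|) ^ j ≤ β t := fun hj t => by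
    rw [hβ, mul_comm]
    exact mul_le_mul_of_nonneg_right (one_add_abs_pow_le hj t) (norm_nonneg _)
  -- domination of the four families
  set r : ℝ := Real.exp (-2 * Real.pi * y) with hr
  have hr0 : 0 ≤ r := (Real.exp_pos _).le
  have hr1 : r < 1 := by rw [hr, Real.exp_lt_one_iff]; nlinarith [Real.pi_pos]
  have d₁ := dominated_family (g := fun n => C * (1 + n) ^ N * r ^ n) hm₁ hwK
    ((summable_one_add_pow_mul_geometric hr0 hr1 N).mul_left C |>.congr fun n => by ring)
    (fun n t => by
      simp only [hF₁]
      rw [norm_mul]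
      calc ‖w t‖ * ‖cexp (2 * Real.pi * I * ((n₀ : ℂ) + n) * lineH y t) * a n x₀‖
          ≤ ‖w t‖ * (1 + |t|) ^ 0 * (C * (1 + n) ^ N * r ^ n) := by
            rw [pow_zero, mul_one]
            exact mul_le_mul_of_nonneg_left (norm_data₁_le hy n (ha n) t) (norm_nonneg _)
        _ ≤ β t * (C * (1 + n) ^ N * r ^ n) :=
            mul_le_mul_of_nonneg_right (hwβ (by omega) t) (by positivity))
  have d₂ := dominated_family
    (g := fun n => 4 * Real.pi * (2 + y) * n₀ * C * (1 + n) ^ (N + 1) * r ^ n) hm₂ hwK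
    ((summable_one_add_pow_mul_geometric hr0 hr1 (N + 1)).mul_left (4 * Real.pi * (2 + y) * n₀ * C)
      |>.congr fun n => by ring)
    (fun n t => by
      simp only [hF₂]
      rw [norm_mul]
      calc ‖w t‖ * ‖2 * Real.pi * I * lineH y t * (node n₀ n : ℂ) *
            cexp (2 * Real.pi * I * ((n₀ : ℂ) + n) * lineH y t) * b n x₀‖
          ≤ ‖w t‖ * ((1 + |t|) ^ 1 *
              (4 * Real.pi * (2 + y) * n₀ * C * (1 + n) ^ (N + 1) * r ^ n)) := by
            rw [pow_one]
            exact mul_le_mul_of_nonneg_left (norm_data₂_le hy hn₀ n (hb n) t) (norm_nonneg _)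
        _ = ‖w t‖ * (1 + |t|) ^ 1 * (4 * Real.pi * (2 + y) * n₀ * C * (1 + n) ^ (N + 1) * r ^ n) := by
            ring
        _ ≤ β t * (4 * Real.pi * (2 + y) * n₀ * C * (1 + n) ^ (N + 1) * r ^ n) :=
            mul_le_mul_of_nonneg_right (hwβ (by omega) t) (by positivity))
  set K₃ : ℝ := y⁻¹ ^ ((d : ℝ) / 2) * (N + 2).factorial * (2 + y) ^ (2 * (N + 2)) *
    ((2 * Real.pi * y) ^ (N + 2))⁻¹ * C with hK₃
  have hK₃0 : 0 ≤ K₃ := by positivity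
  have d₃ := dominated_family
    (g := fun n => K₃ * ((1 + (n : ℝ)) ^ N * (((n₀ : ℝ) + n) ^ (N + 2))⁻¹)) hm₃ hwK
    ((summable_pow_mul_inv_pow_add_two hn₀ N).mul_left K₃)
    (fun n t => by
      simp only [hF₃]
      rw [norm_mul]
      calc ‖w t‖ * ‖(I / lineH y t) ^ ((d : ℂ) / 2) *
            cexp (2 * Real.pi * I * ((n₀ : ℂ) + n) * (-(lineH y t)⁻¹)) * a' n x₀‖
          ≤ ‖w t‖ * ((1 + |t|) ^ (2 * (N + 2)) *
              (K₃ * ((1 + (n : ℝ)) ^ N * (((n₀ : ℝ) + n) ^ (N + 2))⁻¹))) :=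
            mul_le_mul_of_nonneg_left (norm_data₃_le hy hn₀ n (ha' n) t) (norm_nonneg _)
        _ = ‖w t‖ * (1 + |t|) ^ (2 * (N + 2)) *
              (K₃ * ((1 + (n : ℝ)) ^ N * (((n₀ : ℝ) + n) ^ (N + 2))⁻¹)) := by ring
        _ ≤ β t * (K₃ * ((1 + (n : ℝ)) ^ N * (((n₀ : ℝ) + n) ^ (N + 2))⁻¹)) :=
            mul_le_mul_of_nonneg_right (hwβ (by omega) t) (by positivity))
  set K₄ : ℝ := y⁻¹ ^ ((d : ℝ) / 2) * (4 * Real.pi * n₀ * y⁻¹) * (N + 3).factorial *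
    (2 + y) ^ (2 * (N + 3)) * ((2 * Real.pi * y) ^ (N + 3))⁻¹ * C with hK₄
  have hK₄0 : 0 ≤ K₄ := by positivity
  have d₄ := dominated_family
    (g := fun n => K₄ * ((1 + (n : ℝ)) ^ (N + 1) * (((n₀ : ℝ) + n) ^ (N + 1 + 2))⁻¹)) hm₄ hwK
    ((summable_pow_mul_inv_pow_add_two hn₀ (N + 1)).mul_left K₄)
    (fun n t => by
      simp only [hF₄]
      rw [norm_mul, show N + 1 + 2 = N + 3 by ring]
      calc ‖w t‖ * ‖(I / lineH y t) ^ ((d : ℂ) / 2) * (2 * Real.pi * I * (-(lineH y t)⁻¹) *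
            (node n₀ n : ℂ) * cexp (2 * Real.pi * I * ((n₀ : ℂ) + n) * (-(lineH y t)⁻¹))) * b' n x₀‖
          ≤ ‖w t‖ * ((1 + |t|) ^ (2 * (N + 3)) *
              (K₄ * ((1 + (n : ℝ)) ^ (N + 1) * (((n₀ : ℝ) + n) ^ (N + 3))⁻¹))) :=
            mul_le_mul_of_nonneg_left (norm_data₄_le hy hn₀ n (hb' n) t) (norm_nonneg _)
        _ = β t * (K₄ * ((1 + (n : ℝ)) ^ (N + 1) * (((n₀ : ℝ) + n) ^ (N + 3))⁻¹)) := by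
            simp only [hβ]; ring)
  -- the pointwise Gaussian identity, multiplied by `w t`
  have hpt : ∀ t : ℝ, w t * cexp (Real.pi * I * lineH y t * ‖x₀‖ ^ 2) =
      (∑' n, F₁ n t) + (∑' n, F₂ n t) + (∑' n, F₃ n t) + (∑' n, F₄ n t) := by
    intro t
    have hG := eq_interpolationSum_complexGaussian_of_functionalEquation n₀ a b a' b'
      (lineHPt y hy t) x₀ (hFE t)
    simp only [radialValue_complexGaussian_node, radialDeriv_complexGaussian_node,
      radialValue_fourier_complexGaussian_node, radialDeriv_fourier_complexGaussian_node,
      coe_lineHPt, complexGaussian_apply] at hG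
    rw [hG, mul_add, mul_add, mul_add, ← tsum_mul_left, ← tsum_mul_left, ← tsum_mul_left,
      ← tsum_mul_left]
  -- the integrals of the four families are the data of `S`
  have hI₁ : ∀ n, ∫ t, F₁ n t =
      radialValue (gaussSup w y : EuclideanSpace ℝ (Fin d) → ℂ) (node n₀ n) * a n x₀ := by
    intro n
    rw [radialValue_gaussSup, ← integral_mul_const]
    refine integral_congr_ae (Eventually.of_forall fun t => ?_)
    simp only [hF₁]
    rw [cexp_node_sq]
    ring
  have hI₂ : ∀ n, ∫ t, F₂ n t =
      radialDeriv (gaussSup w y : EuclideanSpace ℝ (Fin d) → ℂ) (node n₀ n) * b n x₀ := by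
    intro n
    rw [radialDeriv_gaussSup hw hw1 hy.le, ← integral_mul_const]
    refine integral_congr_ae (Eventually.of_forall fun t => ?_)
    simp only [hF₂]
    rw [cexp_node_sq]
    ring
  have hI₃ : ∀ n, ∫ t, F₃ n t =
      radialValue (𝓕 (gaussSup w y : EuclideanSpace ℝ (Fin d) → ℂ)) (node n₀ n) * a' n x₀ := by
    intro n
    rw [radialValue_fourier_gaussSup hw hy, ← integral_mul_const]
    refine integral_congr_ae (Eventually.of_forall fun t => ?_)
    simp only [hF₃]
    rw [cexp_node_sq]
    ring
  have hI₄ : ∀ n, ∫ t, F₄ n t =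
      radialDeriv (𝓕 (gaussSup w y : EuclideanSpace ℝ (Fin d) → ℂ)) (node n₀ n) * b' n x₀ := by
    intro n
    rw [radialDeriv_fourier_gaussSup hw hy, ← integral_mul_const]
    refine integral_congr_ae (Eventually.of_forall fun t => ?_)
    simp only [hF₄]
    rw [cexp_node_sq]
    ring
  -- summability of the four series of data (from `‖∫ Fₙ‖ ≤ ∫ ‖Fₙ‖`)
  have hS : ∀ {F : ℕ → ℝ → ℂ} {A : ℕ → ℂ}, (∀ n, ∫ t, F n t = A n) →
      (Summable fun n => ∫ t, ‖F n t‖) → Summable fun n => ‖A n‖ := fun hI hs =>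
    Summable.of_nonneg_of_le (fun n => norm_nonneg _)
      (fun n => by rw [← hI n]; exact norm_integral_le_integral_norm _) hs
  refine ⟨hS hI₁ d₁.2.1, hS hI₂ d₂.2.1, hS hI₃ d₃.2.1, hS hI₄ d₄.2.1, ?_⟩
  -- the formula
  calc gaussSup w y x₀ = ∫ t, w t * cexp (Real.pi * I * lineH y t * ‖x₀‖ ^ 2) := gaussSup_def w y x₀
    _ = ∫ t, (∑' n, F₁ n t) + (∑' n, F₂ n t) + (∑' n, F₃ n t) + (∑' n, F₄ n t) :=
        integral_congr_ae (Eventually.of_forall hpt)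
    _ = (∑' n, ∫ t, F₁ n t) + (∑' n, ∫ t, F₂ n t) + (∑' n, ∫ t, F₃ n t) + (∑' n, ∫ t, F₄ n t) :=
        integral_tsum_add_four d₁ d₂ d₃ d₄
    _ = _ := by simp only [hI₁, hI₂, hI₃, hI₄]

end Main

end Literature.Analysis.Fourier
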